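import Summits.BirchSwinnertonDyer.Rank1Residual.Additive.RamifiedSevenGenusCharacterVanishing
import HarnessLib

set_option autoImplicit false

/-!
# `𝒞₇` genus road (crux `EllipticUnitValueSevenOfGZK`, K7r), the (5)-unit programme (SUMMON GENUS-UNIT-A5), File C2a (memo S7,
# THE χ-LOGARITHM CALCULUS): `Λ_χ(u) := Σ_{g ∈ Gal(L/ℚ)} χ(g)·log‖Φ(g u)‖` is additive in `u`, reads Galois translates as
# character values (`Λ_χ(h·u) = χ(h)⁻¹Λ_χ(u)`), integer group-ring exponents as `Σ_h x_h χ(h)⁻¹`, is blind to complex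
# conjugation, and vanishes for `χ` odd (THEOREMS ONLY; `Λ_χ` is spelled out, never defined)

Cell bsd-cm, seat bsd-cm-k-ty1 g26 (literature-prover); ruled memo `pub/bsd-cm/bsd-cm-k-ty1/g26/G45-typing-memo.md` S7
(c225f82434dc25c5).  The «group-ring exponent calculus» half of S7: the rules by which File C2b will evaluate
`Λ_χ(E₁′ ⋆ ((θu n)²·ξ♯ₙ))` from the master identity ★★★′ (File B3b) — for `L ⊂ ℚ̄` normal, `Φ : ℚ̄ → ℂ`, a character
`χ : Gal(L/ℚ) →* ℂˣ`, and the sum `S_χ(u) = ∑ᶠ g, χ(g)·log‖Φ(g u)‖` of the B-files: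

* §1 `logSum_one`, `logSum_mul`, `logSum_inv`, `logSum_pow`, `logSum_zpow`, `logSum_finprod_zpow_const` — additivity
  (`u, v ≠ 0`).
* §2 `logSum_translate` — `S_χ(h u) = χ(h)⁻¹·S_χ(u)` (reindex `g ↦ g h`); ★ `logSum_finprod_translate_zpow` —
  `S_χ(∏_h (h u)^{x_h}) = (Σ_h x_h·χ(h)⁻¹)·S_χ(u)` for integer exponents `x : Gal(L/ℚ) → ℤ` (the group-ring action on units
  read through `χ̄`).
* §3 `logSum_conj_translate` — `S_χ(c|_L u) = S_χ(u)` (`‖Φ ∘ c‖ = ‖Φ‖`, `Gal(L/ℚ)` commutative);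
  `logSum_eq_zero_of_character_conj_ne_one` — `χ(c|_L) ≠ 1 ⇒ S_χ(u) = 0` (odd characters see no logarithms of `L`).
* §4 (pin, for File D/E) `GenusFrame.torsor_val_modEq`, `torsor_val_modEq_pow`, `torsor_val_coprime` — the torsor system
  `b` of ★★★′ (`Φ(ζsys n) = e^{2πi b n/mₙ}` for ONE `Φ`) satisfies `b (n+1) ≡ b n (mod mₙ)`, hence `(mod 7^{n+1})`, and is
  prime to `7`: exactly the hypotheses `hcompat`, `hb` of File D's `IsLogTable.exists_artinElementFamily` (p789769).

HONEST LABEL: bookkeeping identities; no definition, no named fact, no instance; nothing closes; stmt-BirchSwinnertonDyer-19945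
OPEN; K1ᵘ NOT proved (C2b: the `χ(Xₙ)` dictionary + `E₁′` + the vanishing, and File E ahead); no summit statement is proved
by this seat.

## References
* L. C. Washington, *Introduction to Cyclotomic Fields* (1997) §8.3 (χ-components of units, `Σ χ(σ)⁻¹ log|u^σ|`) [Washington1997].
* S. Lang, *Cyclotomic Fields I–II* (1990) Ch. 3 §5 (PDF p. 71) [Lang1990]; T. Tsuji, J. Number Theory 78 (1999) §6 [Tsuji1999].
* Tree: Files B2a/B2b/C1 (this seat).
-/

noncomputable section

open scoped NumberField ComplexConjugate
open Field

namespace Summit.BirchSwinnertonDyer.Rank1Residual.Additive.GenusSeven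

section Calculus

variable (L : IntermediateField ℚ (AlgebraicClosure ℚ)) (Φ : AlgebraicClosure ℚ →+* ℂ) (χ : (L ≃ₐ[ℚ] L) →* ℂˣ)

/-! ## §1 Additivity -/

/-- `S_χ(1) = 0`. [cite: Washington1997, §8.3] -/
theorem logSum_one :
    ∑ᶠ g : L ≃ₐ[ℚ] L, ((χ g : ℂˣ) : ℂ) * (Real.log ‖Φ (((g (1 : L) : L)) : AlgebraicClosure ℚ)‖ : ℂ) = 0 := by
  refine finsum_eq_zero_of_forall_eq_zero fun g => ?_
  rw [map_one, OneMemClass.coe_one, map_one, norm_one, Real.log_one, Complex.ofReal_zero, mul_zero]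

/-- **Additivity**: `S_χ(u v) = S_χ(u) + S_χ(v)` for `u, v ≠ 0`. [cite: Washington1997, §8.3] -/
theorem logSum_mul [FiniteDimensional ℚ L] {u v : L} (hu : u ≠ 0) (hv : v ≠ 0) :
    ∑ᶠ g : L ≃ₐ[ℚ] L, ((χ g : ℂˣ) : ℂ) * (Real.log ‖Φ (((g (u * v) : L)) : AlgebraicClosure ℚ)‖ : ℂ) =
      ∑ᶠ g : L ≃ₐ[ℚ] L, ((χ g : ℂˣ) : ℂ) * (Real.log ‖Φ (((g u : L)) : AlgebraicClosure ℚ)‖ : ℂ) +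
        ∑ᶠ g : L ≃ₐ[ℚ] L, ((χ g : ℂˣ) : ℂ) * (Real.log ‖Φ (((g v : L)) : AlgebraicClosure ℚ)‖ : ℂ) := by
  rw [← finsum_add_distrib (Set.toFinite _) (Set.toFinite _)]
  refine finsum_congr fun g => ?_
  have hu' : ‖Φ ((g u : L) : AlgebraicClosure ℚ)‖ ≠ 0 := by
    rw [norm_ne_zero_iff, map_ne_zero]; exact_mod_cast (map_ne_zero g).mpr hu
  have hv' : ‖Φ ((g v : L) : AlgebraicClosure ℚ)‖ ≠ 0 := by
    rw [norm_ne_zero_iff, map_ne_zero]; exact_mod_cast (map_ne_zero g).mpr hv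
  rw [map_mul, MulMemClass.coe_mul, map_mul, norm_mul, Real.log_mul hu' hv', Complex.ofReal_add, mul_add]

/-- `S_χ(u⁻¹) = −S_χ(u)`. [cite: Washington1997, §8.3] -/
theorem logSum_inv (u : L) :
    ∑ᶠ g : L ≃ₐ[ℚ] L, ((χ g : ℂˣ) : ℂ) * (Real.log ‖Φ (((g u⁻¹ : L)) : AlgebraicClosure ℚ)‖ : ℂ) =
      -∑ᶠ g : L ≃ₐ[ℚ] L, ((χ g : ℂˣ) : ℂ) * (Real.log ‖Φ (((g u : L)) : AlgebraicClosure ℚ)‖ : ℂ) := by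
  rw [← finsum_neg_distrib]
  refine finsum_congr fun g => ?_
  rw [map_inv₀, show ((((g u)⁻¹ : L)) : AlgebraicClosure ℚ) = (((g u : L)) : AlgebraicClosure ℚ)⁻¹ from
    map_inv₀ (algebraMap L (AlgebraicClosure ℚ)) _, map_inv₀, norm_inv, Real.log_inv, Complex.ofReal_neg, mul_neg]

/-- `S_χ(u^k) = k·S_χ(u)` (`k ∈ ℕ`). [cite: Washington1997, §8.3] -/
theorem logSum_pow [FiniteDimensional ℚ L] (u : L) (k : ℕ) :
    ∑ᶠ g : L ≃ₐ[ℚ] L, ((χ g : ℂˣ) : ℂ) * (Real.log ‖Φ (((g (u ^ k) : L)) : AlgebraicClosure ℚ)‖ : ℂ) =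
      (k : ℂ) * ∑ᶠ g : L ≃ₐ[ℚ] L, ((χ g : ℂˣ) : ℂ) * (Real.log ‖Φ (((g u : L)) : AlgebraicClosure ℚ)‖ : ℂ) := by
  rw [mul_finsum' _ _ (Set.toFinite _)]
  refine finsum_congr fun g => ?_
  rw [map_pow, show ((((g u) ^ k : L)) : AlgebraicClosure ℚ) = (((g u : L)) : AlgebraicClosure ℚ) ^ k from
    map_pow (algebraMap L (AlgebraicClosure ℚ)) _ k, map_pow, norm_pow, Real.log_pow, Complex.ofReal_mul,
    Complex.ofReal_natCast]
  ring

/-- `S_χ(u^k) = k·S_χ(u)` (`k ∈ ℤ`). [cite: Washington1997, §8.3] -/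
theorem logSum_zpow [FiniteDimensional ℚ L] (u : L) (k : ℤ) :
    ∑ᶠ g : L ≃ₐ[ℚ] L, ((χ g : ℂˣ) : ℂ) * (Real.log ‖Φ (((g (u ^ k) : L)) : AlgebraicClosure ℚ)‖ : ℂ) =
      (k : ℂ) * ∑ᶠ g : L ≃ₐ[ℚ] L, ((χ g : ℂˣ) : ℂ) * (Real.log ‖Φ (((g u : L)) : AlgebraicClosure ℚ)‖ : ℂ) := by
  rw [mul_finsum' _ _ (Set.toFinite _)]
  refine finsum_congr fun g => ?_
  rw [map_zpow₀, show ((((g u) ^ k : L)) : AlgebraicClosure ℚ) = (((g u : L)) : AlgebraicClosure ℚ) ^ k from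
    map_zpow₀ (algebraMap L (AlgebraicClosure ℚ)) _ k, map_zpow₀, norm_zpow, Real.log_zpow, Complex.ofReal_mul,
    Complex.ofReal_intCast]
  ring

/-! ## §2 Galois translates and integer group-ring exponents -/

/-- **`S_χ(h u) = χ(h)⁻¹·S_χ(u)`** (reindex the sum by `g ↦ g h`). [cite: Washington1997, §8.3 («Σ χ(σ)⁻¹ log|u^σ|»)] -/
theorem logSum_translate [FiniteDimensional ℚ L] (h : L ≃ₐ[ℚ] L) (u : L) :
    ∑ᶠ g : L ≃ₐ[ℚ] L, ((χ g : ℂˣ) : ℂ) * (Real.log ‖Φ (((g (h u) : L)) : AlgebraicClosure ℚ)‖ : ℂ) =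
      ((χ h : ℂˣ) : ℂ)⁻¹ * ∑ᶠ g : L ≃ₐ[ℚ] L, ((χ g : ℂˣ) : ℂ) * (Real.log ‖Φ (((g u : L)) : AlgebraicClosure ℚ)‖ : ℂ) := by
  classical
  rw [finsum_eq_sum_of_fintype, finsum_eq_sum_of_fintype, Finset.mul_sum]
  refine Fintype.sum_equiv (Equiv.mulRight h) _ _ fun g => ?_
  rw [Equiv.coe_mulRight, map_mul, Units.val_mul, AlgEquiv.mul_apply]
  have hh : ((χ h : ℂˣ) : ℂ) ≠ 0 := Units.ne_zero _
  field_simp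

/-- ★ **Integer group-ring exponents are read through `χ̄`**: for `x : Gal(L/ℚ) → ℤ` and `u ≠ 0`,
`S_χ(∏_h (h u)^{x_h}) = (Σ_h x_h·χ(h)⁻¹)·S_χ(u)`. [cite: Washington1997, §8.3] -/
theorem logSum_finprod_translate_zpow [FiniteDimensional ℚ L] {u : L} (hu : u ≠ 0) (x : (L ≃ₐ[ℚ] L) → ℤ) :
    ∑ᶠ g : L ≃ₐ[ℚ] L, ((χ g : ℂˣ) : ℂ) *
        (Real.log ‖Φ (((g (∏ᶠ h : L ≃ₐ[ℚ] L, (h u) ^ (x h)) : L)) : AlgebraicClosure ℚ)‖ : ℂ) =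
      (∑ᶠ h : L ≃ₐ[ℚ] L, (x h : ℂ) * ((χ h : ℂˣ) : ℂ)⁻¹) *
        ∑ᶠ g : L ≃ₐ[ℚ] L, ((χ g : ℂˣ) : ℂ) * (Real.log ‖Φ (((g u : L)) : AlgebraicClosure ℚ)‖ : ℂ) := by
  classical
  -- induction over the finite product, via `Finset.prod`
  rw [finprod_eq_prod_of_fintype, finsum_eq_sum_of_fintype (f := fun h => (x h : ℂ) * ((χ h : ℂˣ) : ℂ)⁻¹)]
  induction (Finset.univ : Finset (L ≃ₐ[ℚ] L)) using Finset.induction_on with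
  | empty =>
    rw [Finset.prod_empty, Finset.sum_empty, zero_mul]
    exact logSum_one L Φ χ
  | @insert h s hnot ih =>
    have hne : ∀ t : Finset (L ≃ₐ[ℚ] L), (∏ k ∈ t, (k u) ^ (x k)) ≠ 0 := fun t =>
      Finset.prod_ne_zero_iff.mpr fun k _ => zpow_ne_zero _ ((map_ne_zero k).mpr hu)
    rw [Finset.prod_insert hnot, Finset.sum_insert hnot,
      logSum_mul L Φ χ (zpow_ne_zero _ ((map_ne_zero h).mpr hu)) (hne s), ih, logSum_zpow, logSum_translate, add_mul]
    ring

/-! ## §3 Complex conjugation and odd characters -/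

/-- **`S_χ` is blind to complex conjugation**: `S_χ(c|_L u) = S_χ(u)` for `Φ ∘ c = conj ∘ Φ` and `Gal(L/ℚ)` commutative
(`‖Φ(g c u)‖ = ‖Φ(c g u)‖ = ‖Φ(g u)‖`). [cite: Washington1997, §8.3] -/
theorem logSum_conj_translate [Normal ℚ L] (hcomm : ∀ a b : L ≃ₐ[ℚ] L, a * b = b * a)
    {c : AlgebraicClosure ℚ ≃ₐ[ℚ] AlgebraicClosure ℚ} (hc : ∀ x : AlgebraicClosure ℚ, Φ (c x) = conj (Φ x)) (u : L) :
    ∑ᶠ g : L ≃ₐ[ℚ] L, ((χ g : ℂˣ) : ℂ) *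
        (Real.log ‖Φ (((g (c.restrictNormal L u) : L)) : AlgebraicClosure ℚ)‖ : ℂ) =
      ∑ᶠ g : L ≃ₐ[ℚ] L, ((χ g : ℂˣ) : ℂ) * (Real.log ‖Φ (((g u : L)) : AlgebraicClosure ℚ)‖ : ℂ) := by
  refine finsum_congr fun g => ?_
  rw [← AlgEquiv.mul_apply, hcomm, AlgEquiv.mul_apply, coe_restrictNormal_apply, norm_map_complexConjugation hc]

/-- **Odd characters see no logarithms**: if `χ(c|_L) ≠ 1` then `S_χ(u) = 0` for every `u ∈ L`
(`S_χ(c u) = χ(c)⁻¹S_χ(u)` by §2 and `= S_χ(u)` by blindness). [cite: Washington1997, §8.3] -/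
theorem logSum_eq_zero_of_character_conj_ne_one [Normal ℚ L] [FiniteDimensional ℚ L]
    (hcomm : ∀ a b : L ≃ₐ[ℚ] L, a * b = b * a)
    {c : AlgebraicClosure ℚ ≃ₐ[ℚ] AlgebraicClosure ℚ} (hc : ∀ x : AlgebraicClosure ℚ, Φ (c x) = conj (Φ x))
    (hχc : χ (c.restrictNormal L) ≠ 1) (u : L) :
    ∑ᶠ g : L ≃ₐ[ℚ] L, ((χ g : ℂˣ) : ℂ) * (Real.log ‖Φ (((g u : L)) : AlgebraicClosure ℚ)‖ : ℂ) = 0 := by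
  have h1 := logSum_conj_translate L Φ χ hcomm hc u
  rw [logSum_translate] at h1
  have hne : ((χ (c.restrictNormal L) : ℂˣ) : ℂ)⁻¹ ≠ 1 := by
    rw [Ne, inv_eq_one, Units.val_eq_one]
    exact hχc
  have h2 : (((χ (c.restrictNormal L) : ℂˣ) : ℂ)⁻¹ - 1) *
      ∑ᶠ g : L ≃ₐ[ℚ] L, ((χ g : ℂˣ) : ℂ) * (Real.log ‖Φ (((g u : L)) : AlgebraicClosure ℚ)‖ : ℂ) = 0 := by
    rw [sub_mul, one_mul, h1, sub_self]
  exact (mul_eq_zero.mp h2).resolve_left (sub_ne_zero.mpr hne)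

end Calculus

/-! ## §4 The pin: the torsor system of ★★★′ is `7`-adically compatible (the input `hcompat`/`hb` of File D) -/

section Torsor

open Literature.NumberTheory.IwasawaTheory.CyclotomicUnits (rootOfUnityPow)

/-- `Φ(ζsys n) = ζ_{mₙ}^{b n}` in the tree's `rootOfUnityPow` currency, from the `exp`-power form of ★★★′. [cite: Lang1990, Ch. 3 §1 (PDF p. 61)] -/
theorem GenusFrame.apply_ζsys_eq_rootOfUnityPow (F : GenusFrame) {Φ : AlgebraicClosure ℚ →+* ℂ} {n : ℕ}
    [NeZero (7 ^ (n + 1) * F.d)] {b : (ZMod (7 ^ (n + 1) * F.d))ˣ}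
    (hb : Φ (F.ζsys n) =
      Complex.exp (2 * Real.pi * Complex.I / (7 ^ (n + 1) * F.d : ℕ)) ^ ((b : ZMod (7 ^ (n + 1) * F.d))).val) :
    Φ (F.ζsys n) = rootOfUnityPow ((((b : ZMod (7 ^ (n + 1) * F.d))).val : ℕ) : ZMod (7 ^ (n + 1) * F.d)) := by
  rw [hb, ZMod.natCast_zmod_val, Literature.NumberTheory.IwasawaTheory.CyclotomicUnits.rootOfUnityPow_eq_cexp_pow]

/-- ★ **The torsor coordinates are compatible**: if ONE complex embedding `Φ` reads the frame's compatible root system as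
`Φ(ζsys n) = e^{2πi·b n/mₙ}` for all `n` (★★★′), then `b (n+1) ≡ b n (mod mₙ)` — because `ζsys (n+1)^7 = ζsys n` and
`(e^{2πi/m_{n+1}})^7 = e^{2πi/mₙ}`. [cite: Lang1990, Ch. 3 §5 Lemma 2 (PDF p. 72)] [cite: Tsuji1999, §6 (p. 20)] -/
theorem GenusFrame.torsor_val_modEq (F : GenusFrame) {Φ : AlgebraicClosure ℚ →+* ℂ}
    {b : ∀ n : ℕ, (ZMod (7 ^ (n + 1) * F.d))ˣ}
    (hb : ∀ n : ℕ, Φ (F.ζsys n) =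
      Complex.exp (2 * Real.pi * Complex.I / (7 ^ (n + 1) * F.d : ℕ)) ^ ((b n : ZMod (7 ^ (n + 1) * F.d))).val)
    (n : ℕ) :
    ((b (n + 1) : ZMod (7 ^ (n + 1 + 1) * F.d))).val ≡ ((b n : ZMod (7 ^ (n + 1) * F.d))).val
      [MOD 7 ^ (n + 1) * F.d] := by
  haveI h0 : NeZero (7 ^ (n + 1) * F.d) := ⟨(Nat.lt_trans zero_lt_one (F.one_lt_level n)).ne'⟩
  haveI h1 : NeZero (7 ^ (n + 1 + 1) * F.d) := ⟨(Nat.lt_trans zero_lt_one (F.one_lt_level (n + 1))).ne'⟩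
  have hme : 7 ^ (n + 1 + 1) * F.d = 7 ^ (n + 1) * F.d * 7 := by ring
  have hcompat : F.ζsys (n + 1) ^ 7 = F.ζsys n := F.ζsys_compatible.2 n
  have h := congrArg Φ hcompat
  rw [map_pow, F.apply_ζsys_eq_rootOfUnityPow (hb (n + 1)), F.apply_ζsys_eq_rootOfUnityPow (hb n),
    Literature.NumberTheory.IwasawaTheory.CyclotomicUnits.rootOfUnityPow_natCast_pow hme,
    Literature.NumberTheory.IwasawaTheory.CyclotomicUnits.rootOfUnityPow_def,
    Literature.NumberTheory.IwasawaTheory.CyclotomicUnits.rootOfUnityPow_def] at h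
  exact (ZMod.natCast_eq_natCast_iff _ _ _).mp (ZMod.injective_stdAddChar h)

/-- Hence `b (n+1) ≡ b n (mod 7^{n+1})` — the hypothesis `hcompat` of File D's `exists_artinElementFamily`.
[cite: Lang1990, Ch. 10 §1 (PDF p. 167)] -/
theorem GenusFrame.torsor_val_modEq_pow (F : GenusFrame) {Φ : AlgebraicClosure ℚ →+* ℂ}
    {b : ∀ n : ℕ, (ZMod (7 ^ (n + 1) * F.d))ˣ}
    (hb : ∀ n : ℕ, Φ (F.ζsys n) =
      Complex.exp (2 * Real.pi * Complex.I / (7 ^ (n + 1) * F.d : ℕ)) ^ ((b n : ZMod (7 ^ (n + 1) * F.d))).val)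
    (n : ℕ) :
    ((b (n + 1) : ZMod (7 ^ (n + 1 + 1) * F.d))).val ≡ ((b n : ZMod (7 ^ (n + 1) * F.d))).val [MOD 7 ^ (n + 1)] :=
  (F.torsor_val_modEq hb n).of_mul_right F.d

/-- … and every `b n` is prime to `7` — the hypothesis `hb` of File D. [cite: Lang1990, Ch. 10 §1 (PDF p. 167)] -/
theorem GenusFrame.torsor_val_coprime (F : GenusFrame) (n : ℕ) (b : (ZMod (7 ^ (n + 1) * F.d))ˣ) :
    ((b : ZMod (7 ^ (n + 1) * F.d))).val.Coprime 7 :=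
  (ZMod.val_coe_unit_coprime b).coprime_dvd_right (Dvd.intro (7 ^ n * F.d) (by ring))

end Torsor

end Summit.BirchSwinnertonDyer.Rank1Residual.Additive.GenusSeven

end
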